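import Summits.AtomisticToContinuum.Crystallization.Theorems.FrustratedLawDichotomyTwoShellRigidityCut

/-!
# FrustratedLawDichotomy · crux `AperiodicFrustratedLawGap` (stmt-AtomisticToContinuum-27623) — THE ℚ-MIRROR OF `M`:
# `CappedRigidityAt θ η Pat ⟸ CappedCert θ η Pat`, a FINITE statement about 19 points of `ℝ³` (decomp-a2c, prover hand 2, gen 9;
# lens-5 g29 NODE §5 / ASK (3) «ℚ-mirror on M with the nd-COUPLED side conditions»; census TAG 146 (a′) KR18-C)

`M = CappedRigidity θ η` (lens-5 g29 node `FrustratedLawDichotomyTwoShellRigidityCut`, p820342) is a statement about arbitrary finite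
injective `7/10`-separated configurations `y : Fin N → ℝ³`, their scale-free bond graph and the own nearest-neighbour distances `nd` of
every site.  A certificate (interval / ℚ-Gram replay) cannot quantify over that; it needs the FINITE-DIMENSIONAL problem.  This file
types that problem — `CappedCert θ η Pat` — and proves the reduction `CappedCert θ η Pat → CappedRigidityAt θ η Pat` for every pattern
`Pat` whose contact graph separates points (`∀ u ≠ v ∃ w, dist u w = 1 ≠ dist v w`; true for the fcc and the hcp kissing pattern, proved
in the companion file), every `θ` and every `η`.

THE FINITE PROBLEM (centre at `0`, unit `nn_i = 1`; unknowns: the shell `p : Pat → ℝ³` and the caps `c a b` of the squares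
`dist a b = √2`; the «cluster» `K = {0} ∪ range p ∪ caps`).  Every hypothesis below is what the bond-graph semantics PROVABLY give on the
cluster — the nd-COUPLED window set of lens-5 g29 NODE §5 / census KR18-C, not the uncoupled window model:
1. radial window `1 ≤ ‖p u‖ ≤ 1 + θ`;  shell points pairwise distinct;
2. `nd(τu)`-coupling: `‖p u‖ ≤ (1+θ)·‖p u − x‖` for every cluster point `x ≠ p u` (from the radial bond and `nd ≤` every distance);
3. contacts are bonds, coupled at the end `u`: `dist u v = 1 ⇒ ‖p u − p v‖ ≤ (1+θ)·‖p u − x‖` for every cluster point `x ≠ p u`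
   (`x = 0` gives the window `≤ (1+θ)·‖p u‖ ≤ (1+θ)²`; both ends by symmetry of `dist`);
4. non-contacts are non-bonds: `u ≠ v, dist u v ≠ 1 ⇒ min ‖p u‖ ‖p v‖ < ‖p u − p v‖`;
5. caps: `1 ≤ ‖c a b‖`, `c a b` is no shell point, `min (1+θ) ‖c a b − p w‖ < ‖c a b‖` (the cap is NOT bonded to the centre), and
   for each of the four square vertices `w` the cap bond is coupled at both ends:
   `‖c a b − p w‖ ≤ (1+θ)·‖c a b − x‖` (`x ∈ K`, `x ≠ c a b`) and `‖c a b − p w‖ ≤ (1+θ)·‖p w − x‖` (`x ∈ K`, `x ≠ p w`).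
CONCLUSION: `∃ η' < η, ∃ A` linear isometry, `‖p u − A u‖ ≤ η'` for all `u`.
NOT derivable and therefore NOT assumed: cap–cap separation, cap–shell non-bonds outside the square, bonds among caps (lens-5 §5 remark
(1) is reproduced: «cap radius ≥ nn_i» IS clause 5, with no extra hypothesis).  Decision number of record: the sup of the Kabsch
deviation over this set (KR18-C; lens-5 lower bound `0.0225` at `θ = 1/100`, against `η = 1/20`).

Contents: `capCluster`, `CappedCert` (defs); `cappedRigidityAt_of_cert` (the reduction, general `Pat`, `θ`, `η`).
`[folklore]` bookkeeping (elementary rescaling + bond-graph unfolding); no `sorry`, no new axioms, no `instance`/`notation`.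
-/

noncomputable section

namespace Summit.AtomisticToContinuum.Crystallization.Theorems.FrustratedLawDichotomyCappedRigidityCert

open Literature.Geometry.DiscreteGeometry
open Summit.AtomisticToContinuum.Crystallization.Theorems.FrustratedLawDichotomyTwoShellRigidityCut
  (E3 LinkIso Capped CappedRigidityAt)

/-- The **cluster** of the finite problem: the centre `0`, the shell points `p u`, and the caps `c a b` of the squares
(`dist a b = √2`). [folklore] -/
def capCluster {Pat : Finset E3} (p : ↥Pat → E3) (c : ↥Pat → ↥Pat → E3) : Set E3 :=
  insert 0 (Set.range p ∪ {x | ∃ a b : ↥Pat, dist (a : E3) (b : E3) = Real.sqrt 2 ∧ c a b = x})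

/-- **`CappedCert θ η Pat` — the ℚ-mirror of `CappedRigidityAt θ η Pat`** (the finite, certificate-class statement; see the module
docstring for the reading of clauses 1–5).  [LOCAL · certificate target; open at `θ = 1/100, η = 1/20` (census KR18-C decides),
expected with margin at `θ = 1/200`] -/
def CappedCert (θ η : ℝ) (Pat : Finset E3) : Prop :=
  ∀ (p : ↥Pat → E3) (c : ↥Pat → ↥Pat → E3),
    (∀ u : ↥Pat, 1 ≤ ‖p u‖ ∧ ‖p u‖ ≤ 1 + θ) →
    Function.Injective p →
    (∀ u : ↥Pat, ∀ x ∈ capCluster p c, x ≠ p u → ‖p u‖ ≤ (1 + θ) * ‖p u - x‖) →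
    (∀ u v : ↥Pat, dist (u : E3) (v : E3) = 1 →
      ∀ x ∈ capCluster p c, x ≠ p u → ‖p u - p v‖ ≤ (1 + θ) * ‖p u - x‖) →
    (∀ u v : ↥Pat, u ≠ v → dist (u : E3) (v : E3) ≠ 1 → min ‖p u‖ ‖p v‖ < ‖p u - p v‖) →
    (∀ a b : ↥Pat, dist (a : E3) (b : E3) = Real.sqrt 2 →
      1 ≤ ‖c a b‖ ∧ (∀ w : ↥Pat, c a b ≠ p w) ∧
      (∀ w : ↥Pat, (w = a ∨ w = b ∨ (dist (w : E3) (a : E3) = 1 ∧ dist (w : E3) (b : E3) = 1)) →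
        min (1 + θ) ‖c a b - p w‖ < ‖c a b‖ ∧
        (∀ x ∈ capCluster p c, x ≠ c a b → ‖c a b - p w‖ ≤ (1 + θ) * ‖c a b - x‖) ∧
        (∀ x ∈ capCluster p c, x ≠ p w → ‖c a b - p w‖ ≤ (1 + θ) * ‖p w - x‖))) →
    ∃ (η' : ℝ) (A : E3 →ₗᵢ[ℝ] E3), η' < η ∧ ∀ u : ↥Pat, ‖p u - A (u : E3)‖ ≤ η'

/-- **THE REDUCTION `CappedCert θ η Pat → CappedRigidityAt θ η Pat`** for every pattern whose contact graph separates points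
(`hPat`; fcc and hcp do), every `θ` and every `η`.  Proof: rescale the configuration about `y i` by `nn_i⁻¹` (`q j = nn_i⁻¹ • (y j − y i)`),
read every clause of `CappedCert` off the bond-graph semantics (`bondGraph_adj`, `nearestDist_le_dist`) on the cluster
`{i} ∪ τ(Pat) ∪ caps ⊆ range q`, apply the certificate, scale back. [folklore] -/
theorem cappedRigidityAt_of_cert {θ η : ℝ} {Pat : Finset E3}
    (hPat : ∀ u v : ↥Pat, u ≠ v → ∃ w : ↥Pat, dist (u : E3) (w : E3) = 1 ∧ dist (v : E3) (w : E3) ≠ 1)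
    (hcert : CappedCert θ η Pat) : CappedRigidityAt θ η Pat := by
  classical
  intro N y i τ hy _hsep hL hC
  rcases isEmpty_or_nonempty ↥Pat with hE | ⟨⟨u₀⟩⟩
  · exact ⟨η - 1, LinearIsometry.id, by linarith, fun u => (hE.false u).elim⟩
  -- notation
  have hadj : ∀ {j k : Fin N}, (bondGraph θ y).Adj j k ↔
      j ≠ k ∧ dist (y j) (y k) ≤ (1 + θ) * min (nearestDist y j) (nearestDist y k) :=
    fun {j k} => bondGraph_adj
  have hτi : ∀ u, τ u ≠ i := fun u h => (hL.1 u).ne h.symm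
  -- the unit `r = nn_i > 0`
  obtain ⟨k₀, hk₀, hr⟩ := exists_nearestDist_eq_dist y (j := i) ⟨τ u₀, hτi u₀⟩
  set r : ℝ := nearestDist y i with hr_def
  have hr0 : 0 < r := by
    rw [hr]
    exact dist_pos.2 fun h => hk₀ (hy h).symm
  have hri : 0 < r⁻¹ := inv_pos.2 hr0
  -- `0 ≤ 1 + θ` (a bond exists)
  have hθ : 0 ≤ 1 + θ := by
    by_contra hneg
    have hlt := not_le.1 hneg
    obtain ⟨hne, hle⟩ := hadj.1 (hL.1 u₀)
    have hpos : 0 < dist (y i) (y (τ u₀)) := dist_pos.2 fun h => hne (hy h)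
    have hmin : 0 ≤ min (nearestDist y i) (nearestDist y (τ u₀)) :=
      le_min (nearestDist_nonneg _ _) (nearestDist_nonneg _ _)
    nlinarith
  -- the rescaled configuration
  set q : Fin N → E3 := fun j => r⁻¹ • (y j - y i) with hq_def
  have hq_sub : ∀ j l, ‖q j - q l‖ = r⁻¹ * dist (y j) (y l) := by
    intro j l
    simp only [hq_def]
    rw [← smul_sub, sub_sub_sub_cancel_right, norm_smul, Real.norm_of_nonneg hri.le, dist_eq_norm]
  have hqi : q i = 0 := by simp [hq_def]
  have hq_norm : ∀ j, ‖q j‖ = r⁻¹ * dist (y j) (y i) := by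
    intro j
    have := hq_sub j i
    rwa [hqi, sub_zero] at this
  have hq_inj : Function.Injective q := by
    intro j l h
    have h0 : ‖q j - q l‖ = 0 := by rw [h, sub_self, norm_zero]
    rw [hq_sub] at h0
    rcases mul_eq_zero.1 h0 with h1 | h1
    · exact absurd h1 hri.ne'
    · exact hy (dist_eq_zero.1 h1)
  -- generic fact A: every site other than `i` is at rescaled distance `≥ 1`
  have factA : ∀ j, j ≠ i → 1 ≤ ‖q j‖ := by
    intro j hj
    rw [hq_norm, dist_comm]
    have := nearestDist_le_dist y hj
    rw [← hr_def] at this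
    calc (1 : ℝ) = r⁻¹ * r := by field_simp
      _ ≤ r⁻¹ * dist (y i) (y j) := mul_le_mul_of_nonneg_left this hri.le
  -- generic fact R: neighbours of `i` are at rescaled distance `≤ 1 + θ`
  have factR : ∀ j, (bondGraph θ y).Adj i j → ‖q j‖ ≤ 1 + θ := by
    intro j hj
    obtain ⟨-, hle⟩ := hadj.1 hj
    rw [hq_norm, dist_comm]
    have h1 : dist (y i) (y j) ≤ (1 + θ) * r :=
      hle.trans (mul_le_mul_of_nonneg_left (min_le_left _ _) hθ)
    calc r⁻¹ * dist (y i) (y j) ≤ r⁻¹ * ((1 + θ) * r) := mul_le_mul_of_nonneg_left h1 hri.le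
      _ = 1 + θ := by field_simp
  -- generic fact B: a bond `j ∼ k` is no longer than `(1+θ)·dist(j, l)` for every third site `l ≠ j`
  have factB : ∀ j k l, (bondGraph θ y).Adj j k → l ≠ j → ‖q j - q k‖ ≤ (1 + θ) * ‖q j - q l‖ := by
    intro j k l hjk hlj
    obtain ⟨-, hle⟩ := hadj.1 hjk
    have h1 : dist (y j) (y k) ≤ (1 + θ) * dist (y j) (y l) :=
      hle.trans ((mul_le_mul_of_nonneg_left (min_le_left _ _) hθ).trans
        (mul_le_mul_of_nonneg_left (nearestDist_le_dist y hlj) hθ))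
    rw [hq_sub, hq_sub]
    calc r⁻¹ * dist (y j) (y k) ≤ r⁻¹ * ((1 + θ) * dist (y j) (y l)) := mul_le_mul_of_nonneg_left h1 hri.le
      _ = (1 + θ) * (r⁻¹ * dist (y j) (y l)) := by ring
  -- generic fact C: two distinct NON-bonded neighbours `j, k` of `i` are farther apart than the nearer of them is from `i`
  have factC : ∀ j k, (bondGraph θ y).Adj i j → (bondGraph θ y).Adj i k → j ≠ k → ¬ (bondGraph θ y).Adj j k →
      min ‖q j‖ ‖q k‖ < ‖q j - q k‖ := by
    intro j k hij hik hjk hnot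
    have hgt : (1 + θ) * min (nearestDist y j) (nearestDist y k) < dist (y j) (y k) := by
      by_contra hle
      exact hnot (hadj.2 ⟨hjk, not_lt.1 hle⟩)
    obtain ⟨-, hj⟩ := hadj.1 hij
    obtain ⟨-, hk⟩ := hadj.1 hik
    have hj' : dist (y j) (y i) ≤ (1 + θ) * nearestDist y j := by
      rw [dist_comm]; exact hj.trans (mul_le_mul_of_nonneg_left (min_le_right _ _) hθ)
    have hk' : dist (y k) (y i) ≤ (1 + θ) * nearestDist y k := by
      rw [dist_comm]; exact hk.trans (mul_le_mul_of_nonneg_left (min_le_right _ _) hθ)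
    have hmin : min (dist (y j) (y i)) (dist (y k) (y i)) < dist (y j) (y k) := by
      rw [mul_min_of_nonneg _ _ hθ] at hgt
      exact lt_of_le_of_lt (min_le_min hj' hk') hgt
    rw [hq_norm, hq_norm, hq_sub, ← mul_min_of_nonneg _ _ hri.le]
    exact mul_lt_mul_of_pos_left hmin hri
  -- generic fact D: a site `m ≠ i` NOT bonded to `i` but bonded to `a` satisfies `min (1+θ) ‖q m − q a‖ < ‖q m‖`
  have factD : ∀ m a, m ≠ i → ¬ (bondGraph θ y).Adj i m → (bondGraph θ y).Adj m a →
      min (1 + θ) ‖q m - q a‖ < ‖q m‖ := by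
    intro m a hmi hnot hma
    have hgt : (1 + θ) * min (nearestDist y i) (nearestDist y m) < dist (y i) (y m) := by
      by_contra hle
      exact hnot (hadj.2 ⟨hmi.symm, not_lt.1 hle⟩)
    obtain ⟨-, hle⟩ := hadj.1 hma
    have h1 : dist (y m) (y a) ≤ (1 + θ) * nearestDist y m :=
      hle.trans (mul_le_mul_of_nonneg_left (min_le_left _ _) hθ)
    have hmin : min ((1 + θ) * r) (dist (y m) (y a)) < dist (y m) (y i) := by
      rw [mul_min_of_nonneg _ _ hθ, ← hr_def, dist_comm] at hgt
      exact lt_of_le_of_lt (min_le_min le_rfl h1) hgt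
    have := mul_lt_mul_of_pos_left hmin hri
    have h2 : r⁻¹ * ((1 + θ) * r) = 1 + θ := by field_simp
    rw [mul_min_of_nonneg _ _ hri.le, h2] at this
    rw [hq_norm, hq_sub]
    exact this
  -- `τ` is injective (the contact graph of `Pat` separates points)
  have hτ : Function.Injective τ := by
    intro u v huv
    by_contra hne
    obtain ⟨w, huw, hvw⟩ := hPat u v hne
    have h1 : (bondGraph θ y).Adj (τ u) (τ w) := (hL.2.2 u w).2 huw
    rw [huv] at h1
    exact hvw ((hL.2.2 v w).1 h1)
  -- the caps
  set mcap : ↥Pat → ↥Pat → Fin N := fun a b =>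
    if h : dist (a : E3) (b : E3) = Real.sqrt 2 then Classical.choose (hC a b h) else i with hmcap_def
  have hmcap : ∀ a b : ↥Pat, (h : dist (a : E3) (b : E3) = Real.sqrt 2) →
      mcap a b ≠ i ∧ ∀ w : ↥Pat, (w = a ∨ w = b ∨ (dist (w : E3) (a : E3) = 1 ∧ dist (w : E3) (b : E3) = 1)) →
        (bondGraph θ y).Adj (mcap a b) (τ w) := by
    intro a b h
    have : mcap a b = Classical.choose (hC a b h) := by simp [hmcap_def, h]
    rw [this]
    exact Classical.choose_spec (hC a b h)
  -- a cap is not a shell site and is not bonded to the centre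
  have hmcap_ne : ∀ a b : ↥Pat, dist (a : E3) (b : E3) = Real.sqrt 2 → ∀ w : ↥Pat, mcap a b ≠ τ w := by
    intro a b h w heq
    obtain ⟨-, hbond⟩ := hmcap a b h
    have ha : (bondGraph θ y).Adj (mcap a b) (τ a) := hbond a (Or.inl rfl)
    have hb : (bondGraph θ y).Adj (mcap a b) (τ b) := hbond b (Or.inr (Or.inl rfl))
    rw [heq] at ha hb
    have hw : (bondGraph θ y).Adj (mcap a b) (τ w) :=
      hbond w (Or.inr (Or.inr ⟨(hL.2.2 w a).1 ha, (hL.2.2 w b).1 hb⟩))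
    rw [heq] at hw
    exact hw.ne rfl
  have hmcap_centre : ∀ a b : ↥Pat, dist (a : E3) (b : E3) = Real.sqrt 2 → ¬ (bondGraph θ y).Adj i (mcap a b) := by
    intro a b h hadj'
    obtain ⟨w, hw⟩ := hL.2.1 _ hadj'
    exact hmcap_ne a b h w hw.symm
  -- the finite data
  set p : ↥Pat → E3 := fun u => q (τ u) with hp_def
  set c : ↥Pat → ↥Pat → E3 := fun a b => q (mcap a b) with hc_def
  have hS : ∀ x ∈ capCluster p c, ∃ l, q l = x := by
    intro x hx
    rcases hx with rfl | hx
    · exact ⟨i, hqi⟩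
    rcases hx with ⟨u, rfl⟩ | ⟨a, b, -, rfl⟩
    · exact ⟨τ u, rfl⟩
    · exact ⟨mcap a b, rfl⟩
  have hS' : ∀ {x} {j : Fin N}, x ∈ capCluster p c → x ≠ q j → ∃ l, l ≠ j ∧ q l = x := by
    intro x j hx hne
    obtain ⟨l, rfl⟩ := hS x hx
    exact ⟨l, fun h => hne (by rw [h]), rfl⟩
  -- discharge the certificate's hypotheses
  obtain ⟨η', A, hη', hfit⟩ := hcert p c
    (fun u => ⟨factA _ (hτi u), factR _ (hL.1 u)⟩)
    (hq_inj.comp hτ)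
    (by
      intro u x hx hne
      obtain ⟨l, hl, rfl⟩ := hS' hx hne
      have := factB (τ u) i l (hL.1 u).symm hl
      rwa [hqi, sub_zero] at this)
    (by
      intro u v huv x hx hne
      obtain ⟨l, hl, rfl⟩ := hS' hx hne
      exact factB (τ u) (τ v) l ((hL.2.2 u v).2 huv) hl)
    (by
      intro u v huv hd
      exact factC (τ u) (τ v) (hL.1 u) (hL.1 v) (hτ.ne huv) (fun h => hd ((hL.2.2 u v).1 h)))
    (by
      intro a b hab
      obtain ⟨hmi, hbond⟩ := hmcap a b hab
      refine ⟨factA _ hmi, fun w => hq_inj.ne (hmcap_ne a b hab w), fun w hw => ⟨?_, ?_, ?_⟩⟩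
      · exact factD _ _ hmi (hmcap_centre a b hab) (hbond w hw)
      · intro x hx hne
        obtain ⟨l, hl, rfl⟩ := hS' hx hne
        exact factB _ _ l (hbond w hw) hl
      · intro x hx hne
        obtain ⟨l, hl, rfl⟩ := hS' hx hne
        have := factB (τ w) (mcap a b) l (hbond w hw).symm hl
        rwa [norm_sub_rev (q (τ w)) (q (mcap a b))] at this)
  -- scale back
  refine ⟨η', A, hη', fun u => ?_⟩
  have hpu : y (τ u) - y i = r • p u := by
    simp only [hp_def, hq_def]
    rw [smul_smul, mul_inv_cancel₀ hr0.ne', one_smul]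
  calc ‖(y (τ u) - y i) - nearestDist y i • A (u : E3)‖ = ‖r • (p u - A (u : E3))‖ := by
        rw [hpu, ← hr_def, smul_sub]
    _ = r * ‖p u - A (u : E3)‖ := by rw [norm_smul, Real.norm_of_nonneg hr0.le]
    _ ≤ r * η' := mul_le_mul_of_nonneg_left (hfit u) hr0.le
    _ = η' * nearestDist y i := by rw [hr_def, mul_comm]

end Summit.AtomisticToContinuum.Crystallization.Theorems.FrustratedLawDichotomyCappedRigidityCert

end
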